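import Literature.IUT.HodgeTheaters.KitCoreBridgeProp67
import Literature.IUT.HodgeTheaters.PMBaseThetaBridgeProofs
import HarnessLib

/-!
# [IUTchI] Proposition 6.7 lands in Definition 4.6 (ii) AS TYPED IN §4: the output of the algorithm
# `Θ^±-bridge ↦ Θ-bridge` is the dictionary image of a §4 `𝒟`-Θ-bridge (sub-DAG row P67-L05, proofs only)

S. Mochizuki, *Inter-universal Teichmüller theory I*, kurims manuscript (May 2020): Proposition 6.7 p. 167
l. 22–29 ("we obtain a functorial algorithm for constructing a [well-defined, up to a unique isomorphism!]
`𝒟-Θ`-bridge `†𝔇_{T^⋇} → †𝔇_>` as in Definition 4.6, (ii)"), Definition 4.6 (ii) p. 111 l. 46–60 ("such that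
there exist isomorphisms `𝔇_> ⥲ †𝔇_>`, `𝔇_⋇ ⥲ †𝔇_J`, conjugation by which maps `φ^Θ_⋇ ↦ †φ^Θ_⋇`"), Example 4.4
(i)–(iv) pp. 105–107 (the model `φ^Θ_⋇`), Definition 6.1 (i) p. 156 ("a `𝒟`-prime-strip … as in Definition
4.1, (i)") ([IUTchI] Prop 6.7 p.167) [claim: Mochizuki2012, status: disputed] (D-0012 claim key, series
status DISPUTED; PROOF-ONLY companion — no definition, no new `Prop` fact; nothing of the series is asserted
and no side is taken on [IUTchIII] Cor. 3.12).

## What is proved (plan/L5/SUBDAG-IUTchI-Prop67-Prop68i.md row P67-L05, the "RESIDUAL-MERGE")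

abc-iut-L5-t4 typed Prop 6.7 as the named statement `DThetaPMBridge.ThetaBridgeAlgorithm M P hl :=
∀ B, P (B.thetaBridgeData M hl)` with abc-iut-L5-t3's Def 4.6 (ii) predicate as the PARAMETER `P`
(`PMBaseProcessions.lean`); abc-iut-w4-d054 proved it (`PMBaseThetaBridgeProofs.lean`,
`thetaBridgeAlgorithm_of_modelConjugate`) for every `P` closed under Def 4.6 (ii)'s condition read over the
§6 kit's law-less `MultKit.thetaPolyBad`, modulo the hypothesis `hbad` (bi-invariance of `φ^Θ_{v_j}` under
`Aut(𝒟_v)`).  The residual was to instantiate `P` at abc-iut-L5-t3's ACTUAL Def 4.6 (ii) — the structure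
`BaseThetaDatum.DThetaBridge 𝔡` of `BaseHodgeTheaters.lean`, whose field `isModel` is the printed clause over
the GENUINE model `φ^Θ_⋇` of Example 4.4 (`modelThetaBridge`, evaluation sections) — through the §4 ↔ §6
dictionary `KitCore(K, 𝔡)` of `KitCoreBridge.lean`.  The companion `KitCoreBridgeProp67.lean` (same seat,
gen 3) discharges `hbad` (`KitCore.thetaBridgeAlgorithm_isModelConjugate`) and proves the `isModel` clause in
shape (`KitCore.thetaBridgeData_isModel`); THIS file (gen 4) puts abc-iut-L5-t3's ACTUAL structure
`BaseThetaDatum.DThetaBridge` in the binder and proves the two readings of Def 4.6 (ii) equivalent.  Over a kit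
`K` core-agreeing with a §4 datum `𝔡` (`c : 𝔡.KitCore K`) whose Example-4.4 poly-morphisms are the datum's
(`c.ThetaAgrees M`):

* `exists_dThetaBridge_of_isModelConjugate` / `isModelConjugate_of_exists_dThetaBridge` /
  `isModelConjugate_iff_exists_dThetaBridge` — for `𝒟-Θ`-bridge DATA `D` over the kit, the two readings of
  Def 4.6 (ii) AGREE: "`D` is a conjugate of the kit-level model (`thetaPolyBad` at bad `v`, full at good `v`)"
  if and only if "`D` is, place by place through the fully faithful comparison functors of the dictionary,
  isomorphic to an honest §4 `𝒟-Θ`-bridge `B : 𝔡.DThetaBridge` (conjugation by the identifications carrying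
  `B`'s constituent poly-morphisms `†φ^Θ_{j,v}` EXACTLY onto `D`'s)";
* `thetaBridgeAlgorithm_dThetaBridge` (**P67-L05**) — `ThetaBridgeAlgorithm M P hl` HOLDS for
  `P D :=` "`D` is the dictionary image of a `𝒟-Θ`-bridge of Definition 4.6 (ii) [abc-iut-L5-t3's structure]":
  for EVERY `𝒟-Θ^±`-bridge `B` of the kit, the output `B.thetaBridgeData M _` of Proposition 6.7 is, through
  `KitCore`, a §4 `𝒟-Θ`-bridge — unconditionally (no `hbad`, no law hypothesis);
* `thetaBridgeData_poly_eq_transport_modelThetaBridge` — moreover the §4 bridge may be taken to be the MODEL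
  bridge `φ^Θ_⋇ : 𝔇_⋇ → 𝔇_>` of Example 4.4 (iv) itself, matched to the output along abc-iut-L5-t4's canonical
  labelling `T^⋇ ⥲ 𝔽_l^⋇` (`starLabel`, read in `FlStar` by `FlStar.ofFin`): the constituent labelled `q ∈ T^⋇`
  is the conjugate of `φ^Θ_j`, `j = ofFin (starLabel q)` — the printed "`𝔇_⋇ ⥲ †𝔇_{T^⋇}`".

Hypotheses `KitCore` + `ThetaAgrees` are inhabited with `c.e` bijective (`KitCoreBridgeWitness.lean`,
`exists_kitCore_thetaAgrees`), so none of this is vacuous.  Every `theorem` is kernel-checked; typed ≠ proved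
elsewhere.
-/

namespace Literature.IUT.HodgeTheaters

open CategoryTheory

universe u

namespace BaseThetaDatum.KitCore

variable {𝔡 : BaseThetaDatum.{u}} {K : PMBaseKit.{u} 𝔡.l} {c : 𝔡.KitCore K} {M : K.MultKit}

/-! ### The two readings of Definition 4.6 (ii) agree through the dictionary -/

/-- **Def 4.6 (ii), kit reading ⇒ §4 reading.**  If `𝒟-Θ`-bridge data `D` over the kit is a conjugate of the
kit-level model — a bijection `J ⥲ {1, …, l^⋇}`, isomorphisms `κ_j : 𝒟_v ⥲ †𝒟_{j,v}`, `δ : 𝒟_v ⥲ †𝒟_{>,v}` with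
`†φ^Θ_{j,v} = δ ∘ φ^Θ_{v_j} ∘ κ_j⁻¹` (`thetaPolyBad` at bad `v`, all isomorphisms at good `v`) — then `D` is the
dictionary image of an honest §4 `𝒟-Θ`-bridge of abc-iut-L5-t3's Definition 4.6 (ii) (`BaseThetaDatum.DThetaBridge`):
namely of the MODEL bridge `φ^Θ_⋇ : 𝔇_⋇ → 𝔇_>` of Example 4.4 (iv) (`modelThetaBridge`: evaluation sections of label
`j` at bad `v`, "the full poly-isomorphism" at good `v`), its constituents being carried EXACTLY onto `D`'s by
conjugation with the evident identifications.  Uses `ThetaAgrees` (the kit's `φ^Θ_{v_j}` IS Example 4.4's)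
and, at good places, fullness of the comparison functor.
([IUTchI] Def 4.6 (ii) p.111) [claim: Mochizuki2012, status: disputed] -/
theorem exists_dThetaBridge_of_isModelConjugate (hM : c.ThetaAgrees M) (D : K.DThetaBridgeData)
    (hD : ∃ (e : D.J ≃ Fin ((𝔡.l - 1) / 2)) (κ : ∀ j, (PMBaseKit.DStrip.model K).Iso (D.capsule j))
          (δ : (PMBaseKit.DStrip.model K).Iso D.codomain),
        (∀ (j : D.J) (v : K.V) (hv : v ∈ K.bad), D.poly j v =
            {h | ∃ g ∈ M.thetaPolyBad (e j) v hv, h = (κ j v).inv ≫ g ≫ (δ v).hom}) ∧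
        (∀ (j : D.J) (v : K.V), v ∉ K.bad → D.poly j v =
            {h | ∃ g : K.model v ≅ K.model v, h = (κ j v).inv ≫ g.hom ≫ (δ v).hom})) :
    ∃ (B : 𝔡.DThetaBridge) (ι : D.J ≃ B.J)
      (κ : ∀ j x, (c.amb x).obj (B.capsule (ι j) (c.e x)) ≅ (D.capsule j).obj x)
      (γ : ∀ x, (c.amb x).obj (B.cod (c.e x)) ≅ D.codomain.obj x),
      ∀ j x, D.poly j x =
        {g | ∃ f ∈ B.poly (ι j) (c.e x), g = (κ j x).inv ≫ (c.amb x).map f ≫ (γ x).hom} := by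
  obtain ⟨e, κ, δ, hbad, hgood⟩ := hD
  -- the dictionary `{1, …, l^⋇} ⥲ 𝔽_l^⋇`
  let E : Fin (lStar 𝔡.l) ≃ FlStar 𝔡.l :=
    Equiv.ofBijective (FlStar.ofFin 𝔡.l) (FlStar.ofFin_bijective 𝔡.l 𝔡.l_ne_two)
  -- the model `𝒟-Θ`-bridge of Example 4.4 (iv), an honest inhabitant of Def 4.6 (ii)
  let B : 𝔡.DThetaBridge :=
    { J := FlStar 𝔡.l
      capsule := 𝔡.modelCapsule
      cod := 𝔡.tautStrip
      poly := 𝔡.modelThetaBridge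
      isModel := ⟨Equiv.refl _, fun _ => Iso.refl _, Iso.refl _, fun j v => by ext g; simp [Pi.isoApp_refl]⟩ }
  refine ⟨B, e.trans E, fun j x => c.ambModel x ≪≫ κ j x, fun x => c.ambModel x ≪≫ δ x, fun j x => ?_⟩
  change D.poly j x =
    {g | ∃ f ∈ 𝔡.phiThetaAt (FlStar.ofFin 𝔡.l (e j)) (c.e x) (𝔡.D (c.e x)) (𝔡.D (c.e x)),
      g = (c.ambModel x ≪≫ κ j x).inv ≫ (c.amb x).map f ≫ (c.ambModel x ≪≫ δ x).hom}
  by_cases hx : x ∈ K.bad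
  · -- bad place: `thetaPolyBad (e j)` IS Example 4.4's `φ^Θ_{ofFin (e j)}` read through the dictionary
    rw [hbad j x hx, hM x hx (e j)]
    ext g
    constructor
    · rintro ⟨g₀, ⟨f, hf, rfl⟩, rfl⟩
      exact ⟨f, hf, by simp⟩
    · rintro ⟨f, hf, rfl⟩
      exact ⟨_, ⟨f, hf, rfl⟩, by simp⟩
  · -- good place: the full poly-isomorphism on both sides
    have hv : ¬ 𝔡.IsBad (c.e x) := fun h => hx ((c.mem_bad_iff x).2 h)
    rw [hgood j x hx, phiThetaAt_of_not_isBad _ hv]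
    ext g
    constructor
    · rintro ⟨θ, rfl⟩
      refine ⟨(c.isoPreimage x θ).hom, (inferInstance : IsIso (c.isoPreimage x θ).hom), ?_⟩
      simp [c.map_isoPreimage_hom]
    · rintro ⟨f, hf, rfl⟩
      haveI : IsIso f := hf
      exact ⟨(c.ambModel x).symm ≪≫ (c.amb x).mapIso (asIso f) ≪≫ c.ambModel x, by simp⟩

/-- **Def 4.6 (ii), §4 reading ⇒ kit reading.**  Conversely, if `𝒟-Θ`-bridge data `D` over the kit is the
dictionary image of SOME §4 `𝒟-Θ`-bridge `B : 𝔡.DThetaBridge` (index sets matched by `ι`, constituents carried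
exactly onto `D`'s by conjugation through the comparison functors), then `D` is a conjugate of the kit-level
model: `B`'s constituents are `φ^Θ_{v_{χ(j)}}` between isomorphs (abc-iut-L5-t3's Prop 4.7 (i) `χ_spec`, from
`B.isModel`), every isomorph of `𝒟_v` is `𝒟_v` up to an isomorphism the functor carries along, and `ThetaAgrees`
identifies the result with `thetaPolyBad`. ([IUTchI] Def 4.6 (ii) p.111) [claim: Mochizuki2012, status: disputed] -/
theorem isModelConjugate_of_exists_dThetaBridge (hM : c.ThetaAgrees M) (D : K.DThetaBridgeData)
    (hD : ∃ (B : 𝔡.DThetaBridge) (ι : D.J ≃ B.J)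
      (κ : ∀ j x, (c.amb x).obj (B.capsule (ι j) (c.e x)) ≅ (D.capsule j).obj x)
      (γ : ∀ x, (c.amb x).obj (B.cod (c.e x)) ≅ D.codomain.obj x),
      ∀ j x, D.poly j x =
        {g | ∃ f ∈ B.poly (ι j) (c.e x), g = (κ j x).inv ≫ (c.amb x).map f ≫ (γ x).hom}) :
    ∃ (e : D.J ≃ Fin ((𝔡.l - 1) / 2)) (κ : ∀ j, (PMBaseKit.DStrip.model K).Iso (D.capsule j))
      (δ : (PMBaseKit.DStrip.model K).Iso D.codomain),
      (∀ (j : D.J) (v : K.V) (hv : v ∈ K.bad), D.poly j v =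
          {h | ∃ g ∈ M.thetaPolyBad (e j) v hv, h = (κ j v).inv ≫ g ≫ (δ v).hom}) ∧
      (∀ (j : D.J) (v : K.V), v ∉ K.bad → D.poly j v =
          {h | ∃ g : K.model v ≅ K.model v, h = (κ j v).inv ≫ g.hom ≫ (δ v).hom}) := by
  obtain ⟨B, ι, κ, γ, hpoly⟩ := hD
  let E : Fin (lStar 𝔡.l) ≃ FlStar 𝔡.l :=
    Equiv.ofBijective (FlStar.ofFin 𝔡.l) (FlStar.ofFin_bijective 𝔡.l 𝔡.l_ne_two)
  -- isomorphisms `𝒟_v ⥲ †𝒟_{j,v}`, `𝒟_v ⥲ †𝒟_{>,v}` on the §4 side (all objects are isomorphs of `𝒟_v`)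
  have a : ∀ j x, 𝔡.D (c.e x) ≅ B.capsule (ι j) (c.e x) := fun j x => (𝔡.nonempty_iso _ _ _).some
  have b : ∀ x, 𝔡.D (c.e x) ≅ B.cod (c.e x) := fun x => (𝔡.nonempty_iso _ _ _).some
  refine ⟨ι.trans (B.χ.trans E.symm),
    fun j x => (c.ambModel x).symm ≪≫ (c.amb x).mapIso (a j x) ≪≫ κ j x,
    fun x => (c.ambModel x).symm ≪≫ (c.amb x).mapIso (b x) ≪≫ γ x, fun j x hx => ?_, fun j x hx => ?_⟩
  · -- bad place
    have hj : FlStar.ofFin 𝔡.l (E.symm (B.χ (ι j))) = B.χ (ι j) := E.apply_symm_apply _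
    rw [hpoly j x, B.χ_spec (ι j) (c.e x)]
    change _ = {h | ∃ g ∈ M.thetaPolyBad (E.symm (B.χ (ι j))) x hx, h = _ ≫ g ≫ _}
    rw [hM x hx (E.symm (B.χ (ι j))), hj]
    ext g
    constructor
    · rintro ⟨f, hf, rfl⟩
      refine ⟨(c.ambModel x).inv ≫ (c.amb x).map ((a j x).hom ≫ f ≫ (b x).inv) ≫ (c.ambModel x).hom,
        ⟨(a j x).hom ≫ f ≫ (b x).inv, phiThetaAt_isoComp _ (a j x) (phiThetaAt_compIso _ (b x).symm hf), rfl⟩,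
        ?_⟩
      simp
    · rintro ⟨g₀, ⟨f, hf, rfl⟩, rfl⟩
      refine ⟨(a j x).inv ≫ f ≫ (b x).hom,
        phiThetaAt_isoComp _ (a j x).symm (phiThetaAt_compIso _ (b x) hf), ?_⟩
      simp
  · -- good place
    have hv : ¬ 𝔡.IsBad (c.e x) := fun h => hx ((c.mem_bad_iff x).2 h)
    rw [hpoly j x, B.χ_spec (ι j) (c.e x), phiThetaAt_of_not_isBad _ hv]
    ext g
    constructor
    · rintro ⟨f, hf, rfl⟩
      haveI : IsIso f := hf
      refine ⟨(c.ambModel x).symm ≪≫ (c.amb x).mapIso (a j x ≪≫ asIso f ≪≫ (b x).symm) ≪≫ c.ambModel x, ?_⟩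
      simp
    · rintro ⟨θ, rfl⟩
      refine ⟨(a j x).inv ≫ (c.isoPreimage x θ).hom ≫ (b x).hom, ?_, ?_⟩
      · change IsIso _
        infer_instance
      · simp [c.map_isoPreimage_hom]

/-- **The two readings of Definition 4.6 (ii) are EQUIVALENT for kits of a §4 datum**: `𝒟-Θ`-bridge data over
the kit is a conjugate of the kit-level model (abc-iut-w4-d054's predicate) iff it is the dictionary image of a
§4 `𝒟-Θ`-bridge (abc-iut-L5-t3's structure `BaseThetaDatum.DThetaBridge`).  Hence every kit-level theorem stated
for the former (abc-iut-w5-d228's `DThetaBridgeData.Hom` existence/uniqueness, `KitCore.thetaBridgeData_hom_subsingleton`)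
is a theorem about §4 `𝒟-Θ`-bridges read in the kit, and conversely.
([IUTchI] Def 4.6 (ii) p.111) [claim: Mochizuki2012, status: disputed] -/
theorem isModelConjugate_iff_exists_dThetaBridge (hM : c.ThetaAgrees M) (D : K.DThetaBridgeData) :
    (∃ (e : D.J ≃ Fin ((𝔡.l - 1) / 2)) (κ : ∀ j, (PMBaseKit.DStrip.model K).Iso (D.capsule j))
        (δ : (PMBaseKit.DStrip.model K).Iso D.codomain),
        (∀ (j : D.J) (v : K.V) (hv : v ∈ K.bad), D.poly j v =
            {h | ∃ g ∈ M.thetaPolyBad (e j) v hv, h = (κ j v).inv ≫ g ≫ (δ v).hom}) ∧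
        (∀ (j : D.J) (v : K.V), v ∉ K.bad → D.poly j v =
            {h | ∃ g : K.model v ≅ K.model v, h = (κ j v).inv ≫ g.hom ≫ (δ v).hom})) ↔
    ∃ (B : 𝔡.DThetaBridge) (ι : D.J ≃ B.J)
      (κ : ∀ j x, (c.amb x).obj (B.capsule (ι j) (c.e x)) ≅ (D.capsule j).obj x)
      (γ : ∀ x, (c.amb x).obj (B.cod (c.e x)) ≅ D.codomain.obj x),
      ∀ j x, D.poly j x =
        {g | ∃ f ∈ B.poly (ι j) (c.e x), g = (κ j x).inv ≫ (c.amb x).map f ≫ (γ x).hom} :=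
  ⟨exists_dThetaBridge_of_isModelConjugate hM D, isModelConjugate_of_exists_dThetaBridge hM D⟩

/-! ### P67-L05: Proposition 6.7 outputs a `𝒟-Θ`-bridge of Definition 4.6 (ii) as typed in §4 -/

/-- **[IUTchI] Proposition 6.7, "… a `𝒟-Θ`-bridge `†𝔇_{T^⋇} → †𝔇_>` as in Definition 4.6, (ii)", with Definition
4.6 (ii) = abc-iut-L5-t3's ACTUAL structure `BaseThetaDatum.DThetaBridge`** (sub-DAG row P67-L05): for every base kit
`K` that core-agrees with a §4 datum `𝔡` (`KitCore`, Def 6.1 (i)) and every multiplicative kit `M` whose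
Example-4.4 poly-morphisms are the datum's (`ThetaAgrees`, Prop 6.7 "the poly-morphisms described … in Example 4.4,
(i), (ii)"), the named statement `ThetaBridgeAlgorithm M P _` HOLDS for `P D :=` "`D` is, place by place through the
dictionary, isomorphic to a `𝒟-Θ`-bridge of Definition 4.6 (ii), the identifications carrying its `†φ^Θ_⋇` exactly
onto `D`'s" — i.e. the output of the functorial algorithm applied to ANY `𝒟-Θ^±`-bridge is (the image of) a §4
`𝒟-Θ`-bridge.  Unconditional: no `hbad`, no label-rigidity hypothesis.
([IUTchI] Prop 6.7 p.167) [claim: Mochizuki2012, status: disputed] -/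
theorem thetaBridgeAlgorithm_dThetaBridge (hM : c.ThetaAgrees M) (hl : Odd 𝔡.l) :
    PMBaseKit.DThetaPMBridge.ThetaBridgeAlgorithm M
      (fun D => ∃ (B : 𝔡.DThetaBridge) (ι : D.J ≃ B.J)
          (κ : ∀ j x, (c.amb x).obj (B.capsule (ι j) (c.e x)) ≅ (D.capsule j).obj x)
          (γ : ∀ x, (c.amb x).obj (B.cod (c.e x)) ≅ D.codomain.obj x),
          ∀ j x, D.poly j x =
            {g | ∃ f ∈ B.poly (ι j) (c.e x), g = (κ j x).inv ≫ (c.amb x).map f ≫ (γ x).hom})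
      hl :=
  fun B => exists_dThetaBridge_of_isModelConjugate hM _ (thetaBridgeAlgorithm_isModelConjugate hM hl B)

/-- **P67-L05 with the printed labelling.**  Sharper: the §4 bridge may be taken to be the MODEL `𝒟-Θ`-bridge
`φ^Θ_⋇ : 𝔇_⋇ → 𝔇_>` of Example 4.4 (iv) (capsule of copies of the tautological strip indexed by `𝔽_l^⋇`, constituents
`φ^Θ_{v_j}` = abc-iut-L5-t3's `modelThetaBridge`), matched to the output `†𝔇_{T^⋇} → †𝔇_>` along abc-iut-L5-t4's
canonical labelling `T^⋇ ⥲ 𝔽_l^⋇` of Def 6.4 (i) (`starLabel`, read in `FlStar` through `FlStar.ofFin`): "there exist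
isomorphisms `𝔇_> ⥲ †𝔇_>`, `𝔇_⋇ ⥲ †𝔇_{T^⋇}`, conjugation by which maps `φ^Θ_⋇ ↦ †φ^Θ_⋇`" — the constituent of the
output at the class `q ∈ T^⋇` is EXACTLY the conjugate, through the dictionary, of `φ^Θ_{v_j}` for
`j = ofFin (starLabel q)`. ([IUTchI] Prop 6.7 p.167) [claim: Mochizuki2012, status: disputed] -/
theorem thetaBridgeData_poly_eq_transport_modelThetaBridge (hM : c.ThetaAgrees M) (hl : Odd 𝔡.l)
    (B : K.DThetaPMBridge) :
    ∃ (κ : ∀ (q : B.grpT.AbsStar) x, (c.amb x).obj (𝔡.D (c.e x)) ≅ (B.starCapsule q).obj x)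
      (γ : ∀ x, (c.amb x).obj (𝔡.D (c.e x)) ≅ B.codomain.obj x),
      ∀ (q : B.grpT.AbsStar) x, (B.thetaBridgeData M hl).poly (ULift.up q) x =
        {g | ∃ f ∈ 𝔡.modelThetaBridge (FlStar.ofFin 𝔡.l (B.starLabel hl q)) (c.e x),
          g = (κ q x).inv ≫ (c.amb x).map f ≫ (γ x).hom} := by
  obtain ⟨β, hβ⟩ := B.exists_labelCompatible
  choose κ hκ using hβ
  refine ⟨fun q x => c.ambModel x ≪≫ κ (Quotient.out q.1) x, fun x => c.ambModel x ≪≫ β x, fun q x => ?_⟩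
  change (B.thetaBridgeData M hl).poly (ULift.up q) x =
    {g | ∃ f ∈ 𝔡.phiThetaAt (FlStar.ofFin 𝔡.l (B.starLabel hl q)) (c.e x) (𝔡.D (c.e x)) (𝔡.D (c.e x)),
      g = (c.ambModel x ≪≫ κ (Quotient.out q.1) x).inv ≫ (c.amb x).map f ≫ (c.ambModel x ≪≫ β x).hom}
  by_cases hx : x ∈ K.bad
  · ext h
    dsimp only [PMBaseKit.DThetaPMBridge.thetaBridgeData, PMBaseKit.DThetaPMBridge.starCapsule,
      PMBaseKit.DThetaPMBridge.absCapsule]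
    rw [dif_pos hx, hM x hx]
    constructor
    · rintro ⟨α', β', -, g, ⟨f, hf, rfl⟩, rfl⟩
      -- re-centre the conjugating isomorphisms on `κ`, `β` using bi-saturation of `φ^Θ_{v_j}` (Ex 4.4 (ii))
      refine ⟨(c.isoPreimage x (κ (Quotient.out q.1) x ≪≫ α'.symm)).hom ≫ f ≫
          (c.isoPreimage x (β' ≪≫ (β x).symm)).hom,
        phiThetaAt_isoComp _ (c.isoPreimage x _) (phiThetaAt_compIso _ (c.isoPreimage x _) hf), ?_⟩
      simp [c.map_isoPreimage_hom]
    · rintro ⟨f, hf, rfl⟩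
      exact ⟨κ (Quotient.out q.1) x, β x, fun f' hf' => hκ (Quotient.out q.1) f' hf' x,
        (c.ambModel x).inv ≫ (c.amb x).map f ≫ (c.ambModel x).hom, ⟨f, hf, rfl⟩, by simp⟩
  · have hv : ¬ 𝔡.IsBad (c.e x) := fun h => hx ((c.mem_bad_iff x).2 h)
    rw [phiThetaAt_of_not_isBad _ hv]
    ext h
    dsimp only [PMBaseKit.DThetaPMBridge.thetaBridgeData, PMBaseKit.DThetaPMBridge.starCapsule,
      PMBaseKit.DThetaPMBridge.absCapsule]
    rw [dif_neg hx]
    constructor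
    · rintro ⟨f, rfl⟩
      refine ⟨(c.isoPreimage x (κ (Quotient.out q.1) x ≪≫ f ≪≫ (β x).symm)).hom,
        (inferInstance : IsIso (c.isoPreimage x _).hom), ?_⟩
      simp [c.map_isoPreimage_hom]
    · rintro ⟨f₀, hf₀, rfl⟩
      haveI : IsIso f₀ := hf₀
      refine ⟨(κ (Quotient.out q.1) x).symm ≪≫
          ((c.ambModel x).symm ≪≫ (c.amb x).mapIso (asIso f₀) ≪≫ c.ambModel x) ≪≫ β x, ?_⟩
      simp

end BaseThetaDatum.KitCore

end Literature.IUT.HodgeTheaters
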